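import Summits.AtomisticToContinuum.HydrodynamicLimit.Theorems.CorrectorPressureDecay.Negative.AllAmplitudes

/-!
# `CorrectorPressureDecay` — negative knowledge (a.6): the normalisation `|φ| ≤ 1` is load-bearing (jointly with `∃κ`)

Support file for crux `stmt-AtomisticToContinuum-14135` (`AntiMazurCoboundaries.CorrectorPressureDecay`, "X"),
written by the standing disprover (cdisprove seat, cycle 3).

The crux bounds the spatial weight, `|φ| ≤ 1`, and the velocity observable, `|g| ≤ κ` with `κ` the PROVER's. Only the
PRODUCT matters: `F = Σᵢ φ(xᵢ) g(wᵢ)` is unchanged under `(φ, g) ↦ (c φ, c⁻¹ g)`, so deleting `|φ| ≤ 1` while keeping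
`∃κ, |g| ≤ κ` lets every bounded admissible `g` back in through a constant rescaling, and the statement collapses to
the all-amplitudes variant `CorrectorPressureDecayAllAmplitudes`, refuted in `Negative/AllAmplitudes.lean` (p75738:
the energy-shell Donsker–Varadhan floor, witness `K·hW` on the low-energy band). Hence:

* `CorrectorPressureDecayWithoutPhiBound` — X with the hypothesis `(∀ x, |φ x| ≤ 1)` deleted, all other tokens
  verbatim (a variant statement, refuted, not a fact);
* `allAmplitudes_of_withoutPhiBound` — it implies `CorrectorPressureDecayAllAmplitudes` (rescaling
  `φ' = (K/κ) φ`, `g' = (κ/K) g`);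
* `correctorPressureDecay_false_without_phiBound : ¬ CorrectorPressureDecayWithoutPhiBound`.

Reading for provers/planners: the amplitude restriction of X is a restriction on `‖φ‖_∞ · κ`, i.e. on the size of the
one-body potential `2φ(x)g(w)` in the exponent per particle, not on `g` alone; a proof may normalise `‖φ‖_∞ = 1`
but must then spend the smallness of `κ` (it cannot, e.g., first localise `φ` to a small cell and renormalise).
All `[folklore]`.
-/

noncomputable section

open MeasureTheory ProbabilityTheory Set Filter Topology
open scoped ENNReal

namespace Summit.AtomisticToContinuum.HydrodynamicLimit.Theorems.CorrectorPressureDecayNegative.PhiBound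

open Literature.MathematicalPhysics.KineticTheory (T3 V3 hsDiameter localGibbsLaw)
open Literature.Analysis.FluidPDE (HardSphereFlow Config)
open Amplitude (CorrectorPressureDecayAllAmplitudes correctorPressureDecay_false_without_amplitude)

/-- `CorrectorPressureDecay` with the normalisation `(∀ x, |φ x| ≤ 1)` of the spatial weight DELETED (so `φ` ranges
over all continuous functions on `𝕋³`); every other token verbatim, in particular the amplitude clause
`∃ κ > 0, … (∀ v, |g v| ≤ κ)` is kept. A variant statement refuted below, not a fact. -/
def CorrectorPressureDecayWithoutPhiBound : Prop :=
  ∀ (a θ : ℝ) (u₀ : V3), 0 < a → 0 < θ → ∃ σ₀ : ℝ, 0 < σ₀ ∧ ∀ σ : ℝ, 0 < σ → σ < σ₀ →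
    (∀ (N : ℕ) (Φ : HardSphereFlow (Literature.Analysis.FluidPDE.Torus.geometry (Fin 3)) (hsDiameter σ N) (N + 1)),
      IsProbabilityMeasure (localGibbsLaw σ (fun _ => a) (fun _ => u₀) (fun _ => θ) N Φ)) ∧
    ∃ κ : ℝ, 0 < κ ∧ ∀ (φ : T3 → ℝ) (g : V3 → ℝ), Continuous φ → Continuous g →
      (∀ v, |g v| ≤ κ) →
      (∀ (c₀ c₂ : ℝ) (b : V3), ∫ v, g v * (c₀ + inner ℝ b v + c₂ * ‖v‖ ^ 2) ∂stdGaussian V3 = 0) →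
      ∀ δ : ℝ, 0 < δ → ∃ τ₀ : ℝ, 0 < τ₀ ∧ ∃ N₀ : ℕ, ∀ N : ℕ, N₀ ≤ N → ∀ Φ : HardSphereFlow (Literature.Analysis.FluidPDE.Torus.geometry (Fin 3)) (hsDiameter σ N) (N + 1),
        ∃ lag : ℝ, 0 < lag ∧ ∃ W : Config (N + 1) (Fin 3) T3 → ℝ, Measurable W ∧ (∃ C : ℝ, ∀ z, |W z| ≤ C) ∧
          ∫⁻ z, ENNReal.ofReal (Real.exp (2 * ((∑ i, φ (z i).1 * g ((Real.sqrt θ)⁻¹ • ((z i).2 - u₀))) -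
              lag⁻¹ * (W (Φ.flow lag z) - W z))))
            ∂(localGibbsLaw σ (fun _ => a) (fun _ => u₀) (fun _ => θ) N Φ) ≤
            ENNReal.ofReal (Real.exp (δ * (N + 1))) ∧
          ∫⁻ z, ENNReal.ofReal (Real.exp (4 * (τ₀ * ((N + 1 : ℕ) : ℝ) ^ (-(1 / 3 : ℝ)))⁻¹ * |W z|))
            ∂(localGibbsLaw σ (fun _ => a) (fun _ => u₀) (fun _ => θ) N Φ) ≤
            ENNReal.ofReal (Real.exp (δ * (N + 1)))

/-- **Rescaling**: without `|φ| ≤ 1` every bounded admissible `g` is reachable — given `|g| ≤ K`, run the statement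
on `φ' = (K'/κ)·φ`, `g' = (κ/K')·g` (`K' = max K 1`), which is admissible with `|g'| ≤ κ` and has the same
`F = Σ φ(xᵢ)g(wᵢ)`. [folklore] -/
theorem allAmplitudes_of_withoutPhiBound (h : CorrectorPressureDecayWithoutPhiBound) :
    CorrectorPressureDecayAllAmplitudes := by
  intro a θ u₀ ha hθ
  obtain ⟨σ₀, hσ₀, hσ⟩ := h a θ u₀ ha hθ
  refine ⟨σ₀, hσ₀, fun σ hs hs' => ?_⟩
  obtain ⟨hprob, κ, hκ, hmain⟩ := hσ σ hs hs'
  refine ⟨hprob, fun φ g hφc hgc _hφb hgb horth δ hδ => ?_⟩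
  obtain ⟨K, hK⟩ := hgb
  set K' : ℝ := max K 1 with hK'
  have hK'pos : 0 < K' := lt_of_lt_of_le one_pos (le_max_right _ _)
  have hgK' : ∀ v, |g v| ≤ K' := fun v => (hK v).trans (le_max_left _ _)
  set φ' : T3 → ℝ := fun x => (K' / κ) * φ x with hφ'
  set g' : V3 → ℝ := fun v => (κ / K') * g v with hg'
  have hφ'c : Continuous φ' := continuous_const.mul hφc
  have hg'c : Continuous g' := continuous_const.mul hgc
  have hg'b : ∀ v, |g' v| ≤ κ := by
    intro v
    rw [hg', abs_mul, abs_of_pos (div_pos hκ hK'pos)]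
    calc κ / K' * |g v| ≤ κ / K' * K' := mul_le_mul_of_nonneg_left (hgK' v) (div_pos hκ hK'pos).le
      _ = κ := div_mul_cancel₀ κ hK'pos.ne'
  have hg'orth : ∀ (c₀ c₂ : ℝ) (b : V3),
      ∫ v, g' v * (c₀ + inner ℝ b v + c₂ * ‖v‖ ^ 2) ∂stdGaussian V3 = 0 := by
    intro c₀ c₂ b
    simp only [hg', mul_assoc]
    rw [integral_const_mul, horth, mul_zero]
  obtain ⟨τ₀, hτ₀, N₀, hN⟩ := hmain φ' g' hφ'c hg'c hg'b hg'orth δ hδ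
  have hfg : ∀ (x : T3) (w : V3), φ' x * g' w = φ x * g w := by
    intro x w
    simp only [hφ', hg']
    field_simp
  refine ⟨τ₀, hτ₀, N₀, fun N hNN Φ => ?_⟩
  obtain ⟨lag, hlag, W, hWm, hWb, h1, h2⟩ := hN N hNN Φ
  refine ⟨lag, hlag, W, hWm, hWb, ?_, h2⟩
  simp_rw [hfg] at h1
  exact h1

/-- **The normalisation `|φ| ≤ 1` is load-bearing (jointly with `∃κ`)**: deleting it makes the crux FALSE, by reduction
to the all-amplitudes refutation `correctorPressureDecay_false_without_amplitude` (energy-shell Donsker–Varadhan floor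
on the low-energy band). [folklore] -/
theorem correctorPressureDecay_false_without_phiBound : ¬ CorrectorPressureDecayWithoutPhiBound := fun h =>
  correctorPressureDecay_false_without_amplitude (allAmplitudes_of_withoutPhiBound h)

end Summit.AtomisticToContinuum.HydrodynamicLimit.Theorems.CorrectorPressureDecayNegative.PhiBound

end
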